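import Literature.MathematicalPhysics.QuantumLattice.HubbardOneBodyDensityMatrix
import Literature.MathematicalPhysics.QuantumLattice.HubbardGrandCanonicalParticleHole
import Literature.MathematicalPhysics.QuantumLattice.GibbsSectorWeightTransfer
import Literature.MathematicalPhysics.QuantumLattice.SectorGroundState
import Literature.MathematicalPhysics.QuantumLattice.FinDimSpectrumSectorGibbsLimit
import HarnessLib

/-!
# The uniform density theorem for the Hubbard model at positive temperature (Lieb–Loss–McCann)

Lieb, Loss and McCann, *Uniform density theorem for the Hubbard model*, J. Math. Phys. **34** (1993)
891–898 (arXiv:cond-mat/9304015), **Theorem** (p. 893, eqs. (5)–(6)), verbatim: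

> THEOREM (Uniform Density in the Generalized Hubbard Model). The canonical and the grand canonical
> density matrices satisfy: `ρ̃_{βσ}(x,x) = ρ_{βσ}(x,x) = 1/2` for all `x ∈ Λ` (5);
> `ρ̃_{βσ}(x,y) = ρ_{βσ}(x,y) = 0` if `x, y ∈ A` or `x, y ∈ B` (6).

Here `Λ = A ⊔ B` is a finite bipartite graph, `ρ_{βσ}(x,y) = Z⁻¹ Tr[c†_{xσ} c_{yσ} e^{-βH}]` is the
grand-canonical one-body density matrix at zero chemical potential of LLM's Hamiltonian (3) (whose
interaction `Σ U (2n_{x↑}-1)(2n_{y↓}-1)` is particle–hole symmetric; for the standard Hubbard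
Hamiltonian `H(t,U) = hopping + U Σ n_{x↑}n_{x↓}` of this tree this is the chemical potential
`μ = U/2`), and `ρ̃_{βσ}` is the canonical one, the trace being "only over the `N`-particle sector",
`N = |Λ|` (half-filled band). The printed proof (p. 893): MacLachlan's hole–particle unitary `W`
(`c_{xσ} ↔ ± c†_{xσ}`, sign by sublattice) leaves `H` and the relevant Hilbert spaces invariant, so
`ρ(x,y) = δ_{xy} - ρ(y,x)` for `x, y` on the same sublattice by the CAR; for real hopping `ρ` is
real, and it is Hermitian, hence `ρ(x,y) = ½ δ_{xy}`.

The companion file `HubbardOneBodyDensityMatrix.lean` proves the GROUND-STATE case (LLM Remark III,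
`β → ∞` of the canonical state = the unique half-filled ground state of Lieb's theorem, `|A| = |B|`,
`t ≠ 0`, `U > 0`). THIS file proves the theorem AS PRINTED, i.e. for the Gibbs states at every inverse
temperature `β`, for the tree's Hubbard Hamiltonian `hamiltonian G t U` on ANY finite graph `G`
carrying a bipartite sign `ε` (`ε x = -ε y` on edges), for EVERY real `t`, `U` and `β` — no
connectedness, no `|A| = |B|`, no sign condition on `U` (as LLM stress: "even though the hopping matrix
elements and interaction are nonuniform").

## What is proved (namespace `Literature.MathematicalPhysics.QuantumLattice`; no definitions, no facts)

* §1 real matrices in the form `Mᴴ = Mᵀ` are closed under products and under the Gibbs weight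
  `e^{-βK}` (`conjTranspose_eq_transpose_gibbsWeight`), have real trace, and give real Gibbs
  expectations (`star_gibbsState_of_conjTranspose_eq_transpose`) — LLM's "`J`" (complex conjugation);
* §2 the abstract theorem behind LLM's proof (`oneBody_eq_half_ite_of_invariances`): a `ℂ`-linear
  functional `φ` on the fermionic Fock operators over orbitals `ι` which is Hermitian
  (`φ(Aᴴ) = conj φ(A)`), real on real matrices, and invariant under the particle–hole unitary
  `P = particleHole ε` of a sign `ε : ι → ℤˣ` satisfies `φ(c†_a c_b) = ½ δ_{ab} φ(1)` whenever
  `ε a = ε b` (LLM's remark after the proof: "only the invariance of `H` under `Y` and the bipartite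
  structure of the lattice have been used" — the orbital-level form covers their spin-dependent
  extension (8));
* §3 **eqs. (5)–(6), grand canonical**: for `K = hamiltonianWith G t U (U/2)` (`= H(t,U) - (U/2)N`,
  the particle–hole invariant point, `particleHole_mul_hamiltonianWith_mul_conjTranspose`) and every
  `β`, `⟨c†_{xσ} c_{yτ}⟩_β = ½ δ_{(x,σ),(y,τ)}` whenever `ε x = ε y`
  (`hubbard_gibbsState_creation_mul_annihilation_halfFilling`); in particular `⟨n_{xσ}⟩_β = ½`,
  `⟨n_x⟩_β = 1`, `⟨N⟩_β = |Λ|` (exact half filling at `μ = U/2` at every temperature);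
* §4 **eqs. (5)–(6), canonical** (`N = |Λ|`): with the particle-number projection
  `Π = diagonal (1_{|s| = |Λ|})` (written out, as in `GibbsSectorWeightTransfer.lean`),
  `⟨Π c†_{xσ} c_{yτ}⟩_{β,K} = ½ δ ⟨Π⟩_{β,K}` for `K = hamiltonianWith G t U μ` and EVERY `μ`
  (`hubbard_gibbsState_numberProj_mul_creation_mul_annihilation`; the chemical potential is a
  constant on the sector — `gibbsWeight_hamiltonianWith_mul_numberProj`,
  `gibbsState_hamiltonianWith_numberProj_mul`);
* §6 **Remark III (ground states)**: the `β → ∞` limits — the tracial ground state of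
  `H - (U/2)N` (`Matrix.groundStateFunctional`, via `Matrix.tendsto_gibbsState_atTop_holds`) and the
  tracial ground state of the half-filled sector (`(hamiltonian G t U).sectorGroundProj
  (nParticleSubmodule |Λ|) |>.projState`, via `tendsto_sectorGibbsAverage_atTop` and
  `projMatrix_map_nParticleSubmodule_eq_diagonal`) satisfy (5)–(6) on every bipartite-signed graph,
  every `t`, `U` — no uniqueness needed (`hubbard_sectorGroundState_creation_mul_annihilation_halfFilling`);
* §7 **the complex case** (LLM p. 893, antiunitary `Y = JW`): `conj ⟨A⟩_{β,K} = ⟨Aᵀᴴ⟩_{β,Kᵀᴴ}`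
  (`star_gibbsState_eq_gibbsState_transpose_conjTranspose`); for Hermitian `K` with `P Kᵀ Pᴴ = K`
  (complex bipartite hopping, e.g. Peierls phases) the grand-canonical and canonical statements hold
  verbatim (`gibbsState_creation_mul_annihilation_eq_half_ite_of_transpose`,
  `gibbsState_numberProj_mul_creation_mul_annihilation_eq_of_transpose`);
* §5 the even torus `(ℤ/Lℤ)^d` (`fermionTorusGraph d L`, `L` even, Yang's sign `torusStagger`):
  both statements for `hubbardTorusWith d L t U μ`.

## Honest scope

LLM's Hamiltonian (3) allows a general real bipartite hopping matrix `T_σ`, site- and spin-dependent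
density–density couplings `U_{xyστ}` and (p. 894) spin–spin couplings; the tree's `hamiltonian G t U`
is the special case of uniform nearest-neighbour hopping `t` and on-site `U`. The abstract §2 is
stated for an arbitrary linear functional, so a more general Hamiltonian only has to supply the three
invariances (§7 gives them for complex, `Y = JW`-invariant Hamiltonians). -- TODO(general form): LLM eq. (3)/(8)
Hamiltonians (general bipartite `T_σ`, `U_{xyστ}`, spin–spin terms) as named tree operators.
The free-fermion corollaries (LLM §I, Wick) and the infinite-volume remark are not formalised.

References: E. H. Lieb, M. Loss, R. J. McCann, J. Math. Phys. 34 (1993) 891 [LiebLossMccann1993];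
A. D. MacLachlan, Mol. Phys. 2 (1959) 271 (the hole–particle pairing); E. H. Lieb, PRL 62 (1989) 1201
[LiebPRL1989] (`P H Pᴴ = H - UN + U|Λ|`); Bratteli–Robinson II §5.3.1 (Gibbs states).
-/

noncomputable section

namespace Literature.MathematicalPhysics.QuantumLattice

open Matrix Finset HubbardWave0 NormedSpace
open scoped ComplexOrder

/-! ### §1 Real matrices (`ᴴ = ᵀ`), their Gibbs weights and traces -/

section RealMatrices

variable {m : Type*} [Fintype m] [DecidableEq m]

omit [Fintype m] in
/-- `1` is real. [folklore] -/
private theorem conjTranspose_eq_transpose_one : (1 : Matrix m m ℂ)ᴴ = (1 : Matrix m m ℂ)ᵀ := by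
  rw [conjTranspose_one, transpose_one]

omit [DecidableEq m] in
/-- Products of real matrices are real. [folklore] -/
private theorem conjTranspose_eq_transpose_mul {A B : Matrix m m ℂ} (hA : Aᴴ = Aᵀ) (hB : Bᴴ = Bᵀ) :
    (A * B)ᴴ = (A * B)ᵀ := by
  rw [conjTranspose_mul, transpose_mul, hA, hB]

omit [Fintype m] [DecidableEq m] in
/-- Differences of real matrices are real. [folklore] -/
private theorem conjTranspose_eq_transpose_sub {A B : Matrix m m ℂ} (hA : Aᴴ = Aᵀ) (hB : Bᴴ = Bᵀ) :
    (A - B)ᴴ = (A - B)ᵀ := by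
  rw [conjTranspose_sub, transpose_sub, hA, hB]

omit [Fintype m] [DecidableEq m] in
/-- Real multiples of real matrices are real. [folklore] -/
private theorem conjTranspose_eq_transpose_real_smul (r : ℝ) {A : Matrix m m ℂ} (hA : Aᴴ = Aᵀ) :
    ((r : ℂ) • A)ᴴ = ((r : ℂ) • A)ᵀ := by
  rw [conjTranspose_smul, transpose_smul, hA, Complex.star_def, Complex.conj_ofReal]

omit [Fintype m] in
/-- Diagonal matrices with real entries are real. [folklore] -/
private theorem conjTranspose_eq_transpose_diagonal_real (d : m → ℝ) :
    (diagonal fun i => ((d i : ℝ) : ℂ))ᴴ = (diagonal fun i => ((d i : ℝ) : ℂ))ᵀ := by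
  rw [diagonal_conjTranspose, diagonal_transpose]
  congr 1
  funext i
  rw [Pi.star_apply, Complex.star_def, Complex.conj_ofReal]

omit [DecidableEq m] in
/-- A real matrix has real trace. [folklore] -/
private theorem star_trace_of_conjTranspose_eq_transpose {M : Matrix m m ℂ} (hM : Mᴴ = Mᵀ) :
    star M.trace = M.trace := by
  rw [← trace_conjTranspose, hM, trace_transpose]

/-- **The Gibbs weight of a real Hamiltonian is real**: `(e^{-βK})ᴴ = (e^{-βK})ᵀ` when `Kᴴ = Kᵀ`
(`(e^X)ᴴ = e^{Xᴴ}`, `(e^X)ᵀ = e^{Xᵀ}`). Lieb–Loss–McCann: "If `T` is real, `ρ_{βσ}` is evidently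
real". [cite: LiebLossMccann1993, proof of Theorem (real case)] -/
theorem conjTranspose_eq_transpose_gibbsWeight (β : ℝ) {K : Matrix m m ℂ} (hK : Kᴴ = Kᵀ) :
    (gibbsWeight β K)ᴴ = (gibbsWeight β K)ᵀ := by
  have h1 : (-(β : ℂ) • K)ᴴ = (-(β : ℂ) • K)ᵀ := by
    rw [conjTranspose_smul, transpose_smul, hK, star_neg, Complex.star_def, Complex.conj_ofReal]
  unfold gibbsWeight
  rw [← Matrix.exp_conjTranspose, h1, Matrix.exp_transpose]

/-- **Real Hamiltonian, real observable ⇒ real Gibbs expectation**: `conj ⟨A⟩_{β,K} = ⟨A⟩_{β,K}`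
when `Kᴴ = Kᵀ` and `Aᴴ = Aᵀ` (LLM's antiunitary `J`: "`Tr L = (Tr K)^*`").
[cite: LiebLossMccann1993, proof of Theorem] -/
theorem star_gibbsState_of_conjTranspose_eq_transpose (β : ℝ) {K A : Matrix m m ℂ}
    (hK : Kᴴ = Kᵀ) (hA : Aᴴ = Aᵀ) : star (gibbsState β K A) = gibbsState β K A := by
  rw [gibbsState_apply, star_mul', star_inv₀, partitionFn,
    star_trace_of_conjTranspose_eq_transpose (conjTranspose_eq_transpose_gibbsWeight β hK),
    star_trace_of_conjTranspose_eq_transpose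
      (conjTranspose_eq_transpose_mul (conjTranspose_eq_transpose_gibbsWeight β hK) hA)]

/-- **Invariance of a Gibbs state under a symmetry of the Hamiltonian**: if `W` is unitary and
`W K Wᴴ = K` then `⟨W A Wᴴ⟩_{β,K} = ⟨A⟩_{β,K}` (LLM: "`WHW = H` and hence
`Z ρ(x,y) = Tr[(W c† W)(W c W) e^{-βH}]`"). [cite: LiebLossMccann1993, proof of Theorem] -/
theorem gibbsState_unitary_conj_of_invariant (β : ℝ) {K W : Matrix m m ℂ} (hWW : Wᴴ * W = 1)
    (hK : W * K * Wᴴ = K) (A : Matrix m m ℂ) :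
    gibbsState β K (W * A * Wᴴ) = gibbsState β K A := by
  have hcomm : W * K = K * W := by
    calc W * K = W * K * (Wᴴ * W) := by rw [hWW, Matrix.mul_one]
      _ = (W * K * Wᴴ) * W := by simp only [Matrix.mul_assoc]
      _ = K * W := by rw [hK]
  have hc : Commute (gibbsWeight β K) W := by
    have h1 : Commute (-(β : ℂ) • K) W := (Commute.smul_left (show Commute K W from hcomm.symm) _)
    exact h1.exp_left
  rw [gibbsState_apply, gibbsState_apply]
  congr 1
  have e : gibbsWeight β K * (W * A * Wᴴ) = W * (gibbsWeight β K * A) * Wᴴ := by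
    simp only [← Matrix.mul_assoc]
    rw [hc.eq]
  rw [e, Matrix.trace_mul_cycle, hWW, Matrix.one_mul]

/-- A Gibbs state is "tracial" against operators commuting with the Hamiltonian:
`⟨A Q⟩_{β,K} = ⟨Q A⟩_{β,K}` if `Q K = K Q` (cyclicity of the trace and `[Q, e^{-βK}] = 0`;
Bratteli–Robinson II §5.3.1, the finite-volume Gibbs state). [cite: BratteliRobinsonII1997, §5.3.1] -/
theorem gibbsState_mul_comm_of_commute (β : ℝ) {K Q : Matrix m m ℂ} (hQ : Q * K = K * Q)
    (A : Matrix m m ℂ) : gibbsState β K (A * Q) = gibbsState β K (Q * A) := by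
  have hc : Commute (gibbsWeight β K) Q := by
    have h1 : Commute (-(β : ℂ) • K) Q := (Commute.smul_left (show Commute K Q from hQ.symm) _)
    exact h1.exp_left
  rw [gibbsState_apply, gibbsState_apply, ← Matrix.mul_assoc, Matrix.trace_mul_comm,
    ← Matrix.mul_assoc, ← hc.eq, Matrix.mul_assoc]

end RealMatrices

/-! ### §2 The abstract uniform density theorem: Hermitian + real + particle–hole invariant functionals -/

section Abstract

variable {ι : Type*} [LinearOrder ι] [Fintype ι]

/-- `ε ε = 1` in `ℂ` for a sign `ε ∈ ℤˣ`. [folklore] -/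
private theorem intCast_units_mul_self (u : ℤˣ) : ((u : ℤ) : ℂ) * ((u : ℤ) : ℂ) = 1 := by
  rcases Int.units_eq_one_or u with h | h <;> simp [h]

/-- **The particle–hole transformation permutes the occupation basis up to phases**
(`P |s⟩ ∝ |sᶜ⟩`, Tasaki (2020) §9.3.3), hence conjugates a diagonal matrix `diag f` to
`diag (f ∘ compl)`: `P diag(f) Pᴴ = diag(s ↦ f(sᶜ))` (unimodular phases).
[cite: Tasaki2020, §9.3.3] [cite: LiebLossMccann1993, proof of Theorem ("leaves … the relevant Hilbert spaces invariant")] -/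
theorem particleHole_mul_diagonal_mul_conjTranspose (ε : ι → ℂ) (hε : ∀ i, ‖ε i‖ = 1)
    (f : Finset ι → ℂ) :
    particleHole ε * diagonal f * (particleHole ε)ᴴ = diagonal (fun s => f sᶜ) := by
  apply matrix_eq_of_mulVec_eq
  intro ψ
  funext t
  rw [← mulVec_mulVec, ← mulVec_mulVec, particleHole_mulVec_apply, mulVec_diagonal,
    particleHole_conjTranspose_mulVec_apply, compl_compl, mulVec_diagonal]
  set w := ∏ i ∈ tᶜ, star (ε i) * jwSign i univ with hw
  calc w * (f tᶜ * (star w * ψ t)) = f tᶜ * ((w * star w) * ψ t) := by ring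
    _ = f tᶜ * ψ t := by rw [hw, particleHoleWeight_mul_star ε hε, one_mul]

/-- **The particle–hole transformation maps the `N`-particle projection to the `(|ι| - N)`-particle
projection**: `P Π_N Pᴴ = Π_{|ι|-N}` (`N ≤ |ι|`); in particular the half-filled sector `N = |ι|/2`
is invariant (LLM: `W` "leaves … the relevant Hilbert spaces invariant").
[cite: LiebLossMccann1993, proof of Theorem] -/
theorem particleHole_mul_numberProj_mul_conjTranspose (ε : ι → ℂ) (hε : ∀ i, ‖ε i‖ = 1) {N : ℕ}
    (hN : N ≤ Fintype.card ι) :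
    particleHole ε * diagonal (fun s : Finset ι => if s.card = N then (1 : ℂ) else 0) *
        (particleHole ε)ᴴ =
      diagonal (fun s : Finset ι => if s.card = Fintype.card ι - N then (1 : ℂ) else 0) := by
  rw [particleHole_mul_diagonal_mul_conjTranspose ε hε]
  congr 1
  funext s
  have hs : s.card ≤ Fintype.card ι := Finset.card_le_univ s
  rw [Finset.card_compl]
  by_cases h : s.card = Fintype.card ι - N
  · rw [if_pos (by omega), if_pos h]
  · rw [if_neg (by omega), if_neg h]

/-- **The hole–particle relation for a particle–hole invariant linear functional** (LLM's
`ρ(x,y) = δ_{xy} - ρ(y,x)`, orbital level): if `φ(P A Pᴴ) = φ(A)` for all `A`, `P` the particle–hole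
unitary of a sign `ε : ι → ℤˣ`, then for all orbitals `a, b`,
`φ(c†_a c_b) = ε_a ε_b (δ_{ab} φ(1) - φ(c†_b c_a))`.
[cite: LiebLossMccann1993, proof of Theorem] -/
theorem oneBody_particleHole_of_invariant (φ : Matrix (Finset ι) (Finset ι) ℂ →ₗ[ℂ] ℂ) (ε : ι → ℤˣ)
    (hP : ∀ A, φ (particleHole (fun i => ((ε i : ℤ) : ℂ)) * A *
      (particleHole (fun i => ((ε i : ℤ) : ℂ)))ᴴ) = φ A)
    (a b : ι) :
    φ (creation a * annihilation b) =
      ((ε a : ℤ) : ℂ) * ((ε b : ℤ) : ℂ) *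
        ((if a = b then φ 1 else 0) - φ (creation b * annihilation a)) := by
  set ε' : ι → ℂ := fun i => ((ε i : ℤ) : ℂ) with hε'
  have hn : ∀ i, ‖ε' i‖ = 1 := fun i => norm_intCast_units _
  set P := particleHole ε' with hPdef
  have hPP : Pᴴ * P = 1 := particleHole_conjTranspose_mul ε' hn
  have hsplit : P * (creation a * annihilation b) * Pᴴ =
      (P * creation a * Pᴴ) * (P * annihilation b * Pᴴ) := by
    simp only [Matrix.mul_assoc]
    rw [← Matrix.mul_assoc Pᴴ P, hPP, Matrix.one_mul]
  have hcar : annihilation a * creation b = (if a = b then 1 else 0) - creation b * annihilation a :=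
    eq_sub_of_add_eq (annihilation_mul_creation_add_creation_mul_annihilation_holds a b)
  have hstar : star (ε' a) = ε' a := by
    simp only [hε']
    exact star_intCast_units _
  have hite : φ (if a = b then (1 : Matrix (Finset ι) (Finset ι) ℂ) else 0) =
      if a = b then φ 1 else 0 := by
    split_ifs <;> simp
  rw [← hP, hsplit, particleHole_mul_creation_mul_conjTranspose ε' hn a,
    particleHole_mul_annihilation_mul_conjTranspose_holds ε' hn b, Matrix.smul_mul,
    Matrix.mul_smul, smul_smul, hcar, hstar, map_smul, map_sub, hite, smul_eq_mul]

/-- **The abstract uniform density theorem** (the content of LLM's proof: "only the invariance of `H`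
under `Y` and the bipartite structure of the lattice have been used"). Let `φ` be a `ℂ`-linear
functional on the Fock operators which is Hermitian (`φ(Aᴴ) = conj φ(A)`), real on real matrices
(`Aᴴ = Aᵀ ⇒ conj φ(A) = φ(A)`), and invariant under the particle–hole unitary of a sign `ε : ι → ℤˣ`.
Then for orbitals `a, b` of the same sign, `φ(c†_a c_b) = ½ δ_{ab} φ(1)`.
[cite: LiebLossMccann1993, Theorem eqs. (5)-(6) and proof] -/
theorem oneBody_eq_half_ite_of_invariances (φ : Matrix (Finset ι) (Finset ι) ℂ →ₗ[ℂ] ℂ)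
    (ε : ι → ℤˣ) (hH : ∀ A, φ Aᴴ = star (φ A)) (hR : ∀ A, Aᴴ = Aᵀ → star (φ A) = φ A)
    (hP : ∀ A, φ (particleHole (fun i => ((ε i : ℤ) : ℂ)) * A *
      (particleHole (fun i => ((ε i : ℤ) : ℂ)))ᴴ) = φ A)
    {a b : ι} (hab : ε a = ε b) :
    φ (creation a * annihilation b) = if a = b then (1 / 2 : ℂ) * φ 1 else 0 := by
  have h1 := oneBody_particleHole_of_invariant φ ε hP a b
  have hsymm : φ (creation b * annihilation a) = φ (creation a * annihilation b) := by
    have hadj : (creation a * annihilation b)ᴴ = creation b * annihilation a := by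
      rw [conjTranspose_mul, annihilation_conjTranspose, creation_conjTranspose]
    rw [← hadj, hH, hR _ (conjTranspose_eq_transpose_mul (conjTranspose_creation_eq_transpose a)
      (conjTranspose_annihilation_eq_transpose b))]
  rw [hab, intCast_units_mul_self, one_mul, hsymm] at h1
  split_ifs at h1 ⊢ with h
  · linear_combination h1 / 2
  · linear_combination h1 / 2

/-- **The abstract theorem for Gibbs states**: if `K` is Hermitian and real (`Kᴴ = Kᵀ`) and invariant
under the particle–hole unitary of `ε` (`P K Pᴴ = K`), then at every `β` and for orbitals of the same
sign, `⟨c†_a c_b⟩_{β,K} = ½ δ_{ab}` — LLM's grand-canonical statement for any such `K`.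
[cite: LiebLossMccann1993, Theorem eqs. (5)-(6)] -/
theorem gibbsState_creation_mul_annihilation_eq_half_ite (β : ℝ) {K : Matrix (Finset ι) (Finset ι) ℂ}
    (hK : K.IsHermitian) (hKr : Kᴴ = Kᵀ) (ε : ι → ℤˣ)
    (hPK : particleHole (fun i => ((ε i : ℤ) : ℂ)) * K * (particleHole (fun i => ((ε i : ℤ) : ℂ)))ᴴ = K)
    {a b : ι} (hab : ε a = ε b) :
    gibbsState β K (creation a * annihilation b) = if a = b then (1 / 2 : ℂ) else 0 := by
  have hn : ∀ i, ‖(fun i => ((ε i : ℤ) : ℂ)) i‖ = 1 := fun i => norm_intCast_units _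
  have hZ : partitionFn β K ≠ 0 := (partitionFn_pos β hK).ne'
  have h := oneBody_eq_half_ite_of_invariances (gibbsState β K) ε
    (fun A => gibbsState_conjTranspose β hK A)
    (fun A hA => star_gibbsState_of_conjTranspose_eq_transpose β hKr hA)
    (fun A => gibbsState_unitary_conj_of_invariant β (particleHole_conjTranspose_mul _ hn) hPK A) hab
  rwa [gibbsState_one β K hZ, mul_one] at h

/-- **The abstract theorem for canonical (sector-conditioned) Gibbs states**: under the same
hypotheses on `K`, if moreover `K` conserves the particle number entrywise and `2N = |ι|` (half
filling), then with `Π = diag(1_{|s| = N})`, `⟨Π c†_a c_b⟩_{β,K} = ½ δ_{ab} ⟨Π⟩_{β,K}` for orbitals of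
the same sign — LLM's canonical statement ("the trace is only over the `N`-particle sector").
[cite: LiebLossMccann1993, Theorem eqs. (5)-(6)] -/
theorem gibbsState_numberProj_mul_creation_mul_annihilation_eq (β : ℝ)
    {K : Matrix (Finset ι) (Finset ι) ℂ} (hK : K.IsHermitian) (hKr : Kᴴ = Kᵀ)
    (hKN : ∀ s s' : Finset ι, K s s' ≠ 0 → s.card = s'.card) (ε : ι → ℤˣ)
    (hPK : particleHole (fun i => ((ε i : ℤ) : ℂ)) * K * (particleHole (fun i => ((ε i : ℤ) : ℂ)))ᴴ = K)
    {N : ℕ} (hN : 2 * N = Fintype.card ι) {a b : ι} (hab : ε a = ε b) :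
    gibbsState β K (diagonal (fun s : Finset ι => if s.card = N then (1 : ℂ) else 0) *
        (creation a * annihilation b)) =
      (if a = b then (1 / 2 : ℂ) else 0) *
        gibbsState β K (diagonal (fun s : Finset ι => if s.card = N then (1 : ℂ) else 0)) := by
  set Q : Matrix (Finset ι) (Finset ι) ℂ :=
    diagonal (fun s : Finset ι => if s.card = N then (1 : ℂ) else 0) with hQdef
  set ε' : ι → ℂ := fun i => ((ε i : ℤ) : ℂ) with hε'
  have hn : ∀ i, ‖ε' i‖ = 1 := fun i => norm_intCast_units _
  set P := particleHole ε' with hPdef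
  have hPP : Pᴴ * P = 1 := particleHole_conjTranspose_mul ε' hn
  -- the three invariances of `φ = ⟨Π ·⟩_{β,K}`
  have hQK : Q * K = K * Q := numberProj_comm_of_card_eq K hKN N
  have hQherm : Qᴴ = Q := numberProj_conjTranspose N
  have hQreal : Qᴴ = Qᵀ := by rw [hQherm, hQdef, diagonal_transpose]
  have hPQ : P * Q * Pᴴ = Q := by
    rw [hQdef, hPdef, particleHole_mul_numberProj_mul_conjTranspose ε' hn (by omega)]
    congr 1
    funext s
    rw [show Fintype.card ι - N = N by omega]
  set φ : Matrix (Finset ι) (Finset ι) ℂ →ₗ[ℂ] ℂ := gibbsState β K ∘ₗ LinearMap.mulLeft ℂ Q with hφ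
  have hφapp : ∀ A, φ A = gibbsState β K (Q * A) := fun A => rfl
  have hH : ∀ A, φ Aᴴ = star (φ A) := by
    intro A
    rw [hφapp, hφapp, ← gibbsState_conjTranspose β hK, conjTranspose_mul, hQherm,
      gibbsState_mul_comm_of_commute β hQK]
  have hR : ∀ A, Aᴴ = Aᵀ → star (φ A) = φ A := by
    intro A hA
    rw [hφapp]
    exact star_gibbsState_of_conjTranspose_eq_transpose β hKr (conjTranspose_eq_transpose_mul hQreal hA)
  have hPinv : ∀ A, φ (P * A * Pᴴ) = φ A := by
    intro A
    have e : Q * (P * A * Pᴴ) = P * (Q * A) * Pᴴ := by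
      calc Q * (P * A * Pᴴ) = (P * Q * Pᴴ) * (P * A * Pᴴ) := by rw [hPQ]
        _ = P * Q * (Pᴴ * P) * A * Pᴴ := by simp only [Matrix.mul_assoc]
        _ = P * (Q * A) * Pᴴ := by rw [hPP, Matrix.mul_one, Matrix.mul_assoc P Q A]
    rw [hφapp, hφapp, e, gibbsState_unitary_conj_of_invariant β hPP hPK]
  have h := oneBody_eq_half_ite_of_invariances φ ε hH hR hPinv hab
  rw [hφapp, hφapp, Matrix.mul_one] at h
  rw [h]
  split_ifs <;> ring

end Abstract

/-! ### §3 The grand-canonical Gibbs state of the Hubbard model at `μ = U/2` -/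

section Hubbard

variable {Λ : Type*} [LinearOrder Λ] [Fintype Λ] (G : SimpleGraph Λ) [DecidableRel G.Adj]

/-- The total particle number is a real (diagonal) matrix (`Nᴴ = Nᵀ`), as needed for the reality of
`H - μN`. [cite: LiebLossMccann1993, proof of Theorem (real case)] -/
theorem conjTranspose_eq_transpose_totalNumber :
    (totalNumber : Matrix (Finset (Orb Λ)) (Finset (Orb Λ)) ℂ)ᴴ = totalNumberᵀ := by
  rw [totalNumber_eq_diagonal_card]
  have h := conjTranspose_eq_transpose_diagonal_real (m := Finset (Orb Λ)) (fun s => (s.card : ℝ))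
  simp only [Complex.ofReal_natCast] at h
  exact h

/-- **The grand-canonical Hubbard Hamiltonian with real hopping is a real matrix**:
`(H(t,U) - μN)ᴴ = (H(t,U) - μN)ᵀ`. [cite: LiebLossMccann1993, proof of Theorem (real case)] -/
theorem conjTranspose_hamiltonianWith_eq_transpose (t U μ : ℝ) :
    (hamiltonianWith G t U μ)ᴴ = (hamiltonianWith G t U μ)ᵀ := by
  rw [hamiltonianWith_eq]
  exact conjTranspose_eq_transpose_sub (conjTranspose_hamiltonian_eq_transpose G t U)
    (conjTranspose_eq_transpose_real_smul μ (conjTranspose_eq_transpose_totalNumber))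

/-- **Particle–hole invariance at `μ = U/2`**: `P (H(t,U) - (U/2)N) Pᴴ = H(t,U) - (U/2)N` for the
particle–hole unitary of a bipartite sign (the fixed point of
`particleHole_mul_hamiltonianWith_mul_conjTranspose`). [cite: LiebPRL1989, Theorem 2 (proof)]
[cite: LiebLossMccann1993, proof of Theorem ("`WHW = H`")] -/
theorem particleHole_mul_hamiltonianWith_half_mul_conjTranspose (ε : Λ → ℤˣ)
    (hε : ∀ x y, G.Adj x y → ε x = -ε y) (t U : ℝ) :
    particleHole (fun i : Orb Λ => ((ε (ofLex i).1 : ℤ) : ℂ)) * hamiltonianWith G t U (U / 2) *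
        (particleHole (fun i : Orb Λ => ((ε (ofLex i).1 : ℤ) : ℂ)))ᴴ =
      hamiltonianWith G t U (U / 2) := by
  rw [particleHole_mul_hamiltonianWith_mul_conjTranspose G ε hε t U (U / 2),
    show U - U / 2 = U / 2 by ring, show (U - 2 * (U / 2)) * (Fintype.card Λ : ℝ) = 0 by ring]
  simp

/-- **Lieb–Loss–McCann, Theorem eqs. (5)–(6), grand canonical.** For the Hubbard model on a finite
graph with a bipartite sign `ε` (`ε x = -ε y` on every edge), every real `t`, `U` and every inverse
temperature `β`, the grand-canonical Gibbs state of `K = H(t,U) - (U/2)N` (zero chemical potential in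
LLM's particle–hole symmetric normalisation (3)) has one-body density matrix
`⟨c†_{xσ} c_{yτ}⟩_β = ½ δ_{(x,σ),(y,τ)}` whenever `x, y` lie on the same sublattice (`ε x = ε y`):
density exactly `½` per orbital and NO one-body correlations inside a sublattice, at every temperature
and coupling. [cite: LiebLossMccann1993, Theorem eqs. (5)-(6)] -/
theorem hubbard_gibbsState_creation_mul_annihilation_halfFilling (ε : Λ → ℤˣ)
    (hε : ∀ x y, G.Adj x y → ε x = -ε y) (t U β : ℝ) {x y : Λ} (hxy : ε x = ε y) (σ τ : Fin 2) :
    gibbsState β (hamiltonianWith G t U (U / 2)) (creation (orb x σ) * annihilation (orb y τ)) =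
      if orb x σ = orb y τ then (1 / 2 : ℂ) else 0 :=
  gibbsState_creation_mul_annihilation_eq_half_ite β (isHermitian_hamiltonianWith G t U (U / 2))
    (conjTranspose_hamiltonianWith_eq_transpose G t U (U / 2)) (fun i : Orb Λ => ε (ofLex i).1)
    (particleHole_mul_hamiltonianWith_half_mul_conjTranspose G ε hε t U)
    (a := orb x σ) (b := orb y τ) (by simpa [orb] using hxy)

/-- **Eq. (6), grand canonical**: `⟨c†_{xσ} c_{yτ}⟩_β = 0` for distinct orbitals on the same sublattice
(in particular `⟨c†_{xσ} c_{yσ}⟩_β = 0` for `x ≠ y` of the same colour, and the on-site spin flip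
`⟨c†_{x↑} c_{x↓}⟩_β = 0`). [cite: LiebLossMccann1993, Theorem eq. (6)] -/
theorem hubbard_gibbsState_creation_mul_annihilation_eq_zero (ε : Λ → ℤˣ)
    (hε : ∀ x y, G.Adj x y → ε x = -ε y) (t U β : ℝ) {x y : Λ} (hxy : ε x = ε y) {σ τ : Fin 2}
    (hne : orb x σ ≠ orb y τ) :
    gibbsState β (hamiltonianWith G t U (U / 2)) (creation (orb x σ) * annihilation (orb y τ)) = 0 := by
  rw [hubbard_gibbsState_creation_mul_annihilation_halfFilling G ε hε t U β hxy, if_neg hne]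

/-- **Eq. (5), grand canonical (uniform density)**: `⟨n_{xσ}⟩_β = ½` for every site and spin.
[cite: LiebLossMccann1993, Theorem eq. (5)] -/
theorem hubbard_gibbsState_numberOp_halfFilling (ε : Λ → ℤˣ) (hε : ∀ x y, G.Adj x y → ε x = -ε y)
    (t U β : ℝ) (x : Λ) (σ : Fin 2) :
    gibbsState β (hamiltonianWith G t U (U / 2)) (numberOp x σ) = 1 / 2 := by
  rw [numberOp, hubbard_gibbsState_creation_mul_annihilation_halfFilling G ε hε t U β rfl, if_pos rfl]

/-- **Eq. (5) summed over spin**: the site density is exactly one, `⟨n_{x↑} + n_{x↓}⟩_β = 1`, at every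
site, temperature and coupling ("`ρ(x,x)` is always exactly equal to one for all `x`").
[cite: LiebLossMccann1993, Theorem eq. (5) and p. 891] -/
theorem hubbard_gibbsState_siteNumber_halfFilling (ε : Λ → ℤˣ)
    (hε : ∀ x y, G.Adj x y → ε x = -ε y) (t U β : ℝ) (x : Λ) :
    gibbsState β (hamiltonianWith G t U (U / 2)) (numberOp x 0 + numberOp x 1) = 1 := by
  rw [map_add, hubbard_gibbsState_numberOp_halfFilling G ε hε, hubbard_gibbsState_numberOp_halfFilling G ε hε]
  norm_num

/-- **Exact half filling of the grand-canonical Gibbs state at `μ = U/2`**: `⟨N⟩_β = |Λ|` for every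
`β` (the positive-temperature companion of `gcNumber_half_coupling`).
[cite: LiebLossMccann1993, Theorem eq. (5) ("`Tr ρ_{βσ} = |Λ|/2`")] -/
theorem hubbard_gibbsState_totalNumber_halfFilling (ε : Λ → ℤˣ)
    (hε : ∀ x y, G.Adj x y → ε x = -ε y) (t U β : ℝ) :
    gibbsState β (hamiltonianWith G t U (U / 2)) totalNumber = Fintype.card Λ := by
  have h2 : (totalNumber : Matrix (Finset (Orb Λ)) (Finset (Orb Λ)) ℂ) =
      ∑ x : Λ, (numberOp x 0 + numberOp x 1) := by
    unfold totalNumber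
    simp [Fin.sum_univ_two]
  rw [h2, map_sum]
  simp only [hubbard_gibbsState_siteNumber_halfFilling G ε hε, Finset.sum_const, Finset.card_univ,
    nsmul_eq_mul, mul_one]

/-! ### §4 The canonical Gibbs state at half filling `N = |Λ|` -/

/-- The grand-canonical Hubbard Hamiltonian conserves the particle number entrywise:
`(H(t,U) - μN)_{ss'} ≠ 0 ⇒ |s| = |s'|` (`H` conserves `N↑` and `N↓`, Lieb 1989, proof of Theorem 1 and
Remark (2)(i); tree `LiebThm1.preservesSectors_hamiltonian`). [cite: LiebPRL1989, proof of Theorem 1] -/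
theorem card_eq_of_hamiltonianWith_apply_ne_zero (t U μ : ℝ) (s s' : Finset (Orb Λ))
    (h : hamiltonianWith G t U μ s s' ≠ 0) : s.card = s'.card := by
  by_contra hne
  apply h
  have hH : hamiltonian G t U s s' = 0 := by
    by_contra hH
    have hp := LiebThm1.preservesSectors_hamiltonian G t U s s' hH
    exact hne (by rw [card_eq_upPart_add_downPart s, card_eq_upPart_add_downPart s', hp.1, hp.2])
  have hss : s ≠ s' := fun h' => hne (by rw [h'])
  rw [hamiltonianWith_eq, Matrix.sub_apply, Matrix.smul_apply, hH, totalNumber_eq_diagonal_card,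
    diagonal_apply_ne _ hss, smul_zero, sub_zero]

/-- A particle-number conserving matrix commutes with every function of the particle number:
`diag(g(|s|)) K = K diag(g(|s|))`. [folklore] -/
private theorem diagonal_card_comm_of_card_eq {ι : Type*} [DecidableEq ι] [Fintype ι] (K : Matrix (Finset ι) (Finset ι) ℂ)
    (hK : ∀ s s' : Finset ι, K s s' ≠ 0 → s.card = s'.card) (g : ℕ → ℂ) :
    diagonal (fun s : Finset ι => g s.card) * K = K * diagonal (fun s : Finset ι => g s.card) := by
  ext s s'
  rw [diagonal_mul, mul_diagonal]
  by_cases h : K s s' = 0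
  · rw [h, mul_zero, zero_mul]
  · rw [hK s s' h, mul_comm]

/-- **The chemical potential is a constant on a particle-number sector**: for every `μ, μ'`,
`e^{-β(H - μN)} Π_N = e^{β(μ-μ')N} · e^{-β(H - μ'N)} Π_N`, `Π_N = diag(1_{|s| = N})`
(`H - μN = (H - μ'N) - (μ - μ')N` with commuting summands, `N = diag(|s|)`) — the formal content of
LLM's definition of the canonical density matrix as a trace "only over the `N`-particle sector",
on which the chemical potential is immaterial. [cite: LiebLossMccann1993, p. 893 (canonical density matrix)] -/
theorem gibbsWeight_hamiltonianWith_mul_numberProj (t U μ μ' β : ℝ) (N : ℕ) :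
    gibbsWeight β (hamiltonianWith G t U μ) *
        diagonal (fun s : Finset (Orb Λ) => if s.card = N then (1 : ℂ) else 0) =
      (Real.exp (β * (μ - μ') * N) : ℂ) •
        (gibbsWeight β (hamiltonianWith G t U μ') *
          diagonal (fun s : Finset (Orb Λ) => if s.card = N then (1 : ℂ) else 0)) := by
  set g : ℕ → ℂ := fun n => (((β * (μ - μ')) * n : ℝ) : ℂ) with hg
  -- `-β(H - μN) = -β(H - μ'N) + diag(β(μ-μ')|s|)`, the two summands commute
  have hsplit : -(β : ℂ) • hamiltonianWith G t U μ =
      -(β : ℂ) • hamiltonianWith G t U μ' + diagonal (fun s : Finset (Orb Λ) => g s.card) := by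
    rw [hamiltonianWith_eq, hamiltonianWith_eq, totalNumber_eq_diagonal_card]
    ext s s'
    simp only [Matrix.smul_apply, Matrix.sub_apply, Matrix.add_apply, diagonal_apply, hg, smul_eq_mul]
    split_ifs with h
    · push_cast
      ring
    · ring
  have hcomm : Commute (-(β : ℂ) • hamiltonianWith G t U μ')
      (diagonal (fun s : Finset (Orb Λ) => g s.card)) :=
    Commute.smul_left (diagonal_card_comm_of_card_eq (hamiltonianWith G t U μ')
      (card_eq_of_hamiltonianWith_apply_ne_zero G t U μ') g).symm _
  have hexp : NormedSpace.exp (diagonal (fun s : Finset (Orb Λ) => g s.card)) =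
      diagonal (fun s : Finset (Orb Λ) => Complex.exp (g s.card)) := by
    rw [Matrix.exp_diagonal]
    congr 1
    funext s
    rw [Pi.exp_def]
    simp [Complex.exp_eq_exp_ℂ]
  have hdiag : diagonal (fun s : Finset (Orb Λ) => Complex.exp (g s.card)) *
      diagonal (fun s : Finset (Orb Λ) => if s.card = N then (1 : ℂ) else 0) =
      (Real.exp (β * (μ - μ') * N) : ℂ) •
        diagonal (fun s : Finset (Orb Λ) => if s.card = N then (1 : ℂ) else 0) := by
    rw [diagonal_mul_diagonal, ← diagonal_smul]
    congr 1
    funext s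
    simp only [Pi.smul_apply, smul_eq_mul]
    split_ifs with h
    · rw [h, hg, mul_one, mul_one, Complex.ofReal_exp]
    · rw [mul_zero, mul_zero]
  unfold gibbsWeight
  rw [hsplit, Matrix.exp_add_of_commute _ _ hcomm, hexp, Matrix.mul_assoc, hdiag, Matrix.mul_smul]

/-- **Sector-conditioned Gibbs expectations do not depend on the chemical potential** (up to the
normalisation): `⟨Π_N A⟩_{β, H-μN} = (Z_{μ}⁻¹ e^{β(μ-μ')N} Z_{μ'}) · ⟨Π_N A⟩_{β, H-μ'N}` for every
observable `A` (canonical expectations "over the `N`-particle sector" do not see `μ`).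
[cite: LiebLossMccann1993, p. 893 (canonical density matrix)] -/
theorem gibbsState_hamiltonianWith_numberProj_mul (t U μ μ' β : ℝ) (N : ℕ)
    (A : Matrix (Finset (Orb Λ)) (Finset (Orb Λ)) ℂ) :
    gibbsState β (hamiltonianWith G t U μ)
        (diagonal (fun s : Finset (Orb Λ) => if s.card = N then (1 : ℂ) else 0) * A) =
      ((partitionFn β (hamiltonianWith G t U μ))⁻¹ * (Real.exp (β * (μ - μ') * N) : ℂ) *
          partitionFn β (hamiltonianWith G t U μ')) *
        gibbsState β (hamiltonianWith G t U μ')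
          (diagonal (fun s : Finset (Orb Λ) => if s.card = N then (1 : ℂ) else 0) * A) := by
  have hZ' : partitionFn β (hamiltonianWith G t U μ') ≠ 0 :=
    (partitionFn_pos β (isHermitian_hamiltonianWith G t U μ')).ne'
  rw [gibbsState_apply, gibbsState_apply, ← Matrix.mul_assoc,
    gibbsWeight_hamiltonianWith_mul_numberProj G t U μ μ' β N, Matrix.smul_mul, trace_smul,
    Matrix.mul_assoc, smul_eq_mul]
  set T := (gibbsWeight β (hamiltonianWith G t U μ') *
    (diagonal (fun s : Finset (Orb Λ) => if s.card = N then (1 : ℂ) else 0) * A)).trace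
  have h1 : partitionFn β (hamiltonianWith G t U μ') * (partitionFn β (hamiltonianWith G t U μ'))⁻¹ = 1 :=
    mul_inv_cancel₀ hZ'
  calc (partitionFn β (hamiltonianWith G t U μ))⁻¹ * ((Real.exp (β * (μ - μ') * N) : ℂ) * T)
      = (partitionFn β (hamiltonianWith G t U μ))⁻¹ * (Real.exp (β * (μ - μ') * N) : ℂ) *
          (partitionFn β (hamiltonianWith G t U μ') * (partitionFn β (hamiltonianWith G t U μ'))⁻¹) *
          T := by rw [h1]; ring
    _ = _ := by ring

/-- **Lieb–Loss–McCann, Theorem eqs. (5)–(6), canonical ensemble at half filling.** For the Hubbard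
model on a finite graph with a bipartite sign `ε`, every real `t`, `U`, `μ`, `β`, and the projection
`Π = diag(1_{|s| = |Λ|})` on the half-filled sector `N = |Λ|`: `⟨Π c†_{xσ} c_{yτ}⟩_{β, H-μN} =
½ δ_{(x,σ),(y,τ)} ⟨Π⟩_{β, H-μN}` whenever `ε x = ε y` — i.e. the CANONICAL Gibbs state
`A ↦ Tr[Π A e^{-βH}]/Tr[Π e^{-βH}]` of the `|Λ|`-electron sector has `ρ̃_{βσ}(x,y) = ½ δ_{xy}` on each
sublattice (the chemical potential is immaterial on a sector). [cite: LiebLossMccann1993, Theorem eqs. (5)-(6)] -/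
theorem hubbard_gibbsState_numberProj_mul_creation_mul_annihilation (ε : Λ → ℤˣ)
    (hε : ∀ x y, G.Adj x y → ε x = -ε y) (t U μ β : ℝ) {x y : Λ} (hxy : ε x = ε y) (σ τ : Fin 2) :
    gibbsState β (hamiltonianWith G t U μ)
        (diagonal (fun s : Finset (Orb Λ) => if s.card = Fintype.card Λ then (1 : ℂ) else 0) *
          (creation (orb x σ) * annihilation (orb y τ))) =
      (if orb x σ = orb y τ then (1 / 2 : ℂ) else 0) *
        gibbsState β (hamiltonianWith G t U μ)
          (diagonal (fun s : Finset (Orb Λ) => if s.card = Fintype.card Λ then (1 : ℂ) else 0)) := by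
  -- the particle–hole symmetric point `μ = U/2`
  have half := gibbsState_numberProj_mul_creation_mul_annihilation_eq β
    (isHermitian_hamiltonianWith G t U (U / 2)) (conjTranspose_hamiltonianWith_eq_transpose G t U (U / 2))
    (card_eq_of_hamiltonianWith_apply_ne_zero G t U (U / 2)) (fun i : Orb Λ => ε (ofLex i).1)
    (particleHole_mul_hamiltonianWith_half_mul_conjTranspose G ε hε t U) (N := Fintype.card Λ)
    (by rw [card_orb]) (a := orb x σ) (b := orb y τ) (by simpa [orb] using hxy)
  -- transfer to `μ`
  have e1 := gibbsState_hamiltonianWith_numberProj_mul G t U μ (U / 2) β (Fintype.card Λ)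
    (creation (orb x σ) * annihilation (orb y τ))
  have e2 := gibbsState_hamiltonianWith_numberProj_mul G t U μ (U / 2) β (Fintype.card Λ) 1
  rw [Matrix.mul_one] at e2
  rw [e1, half, e2]
  ring

/-- **Eq. (6), canonical**: `Tr[Π c†_{xσ} c_{yτ} e^{-β(H-μN)}] = 0` (hence the canonical
`ρ̃(xσ, yτ) = 0`) for distinct orbitals on the same sublattice. [cite: LiebLossMccann1993, Theorem eq. (6)] -/
theorem hubbard_gibbsState_numberProj_mul_creation_mul_annihilation_eq_zero (ε : Λ → ℤˣ)
    (hε : ∀ x y, G.Adj x y → ε x = -ε y) (t U μ β : ℝ) {x y : Λ} (hxy : ε x = ε y) {σ τ : Fin 2}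
    (hne : orb x σ ≠ orb y τ) :
    gibbsState β (hamiltonianWith G t U μ)
        (diagonal (fun s : Finset (Orb Λ) => if s.card = Fintype.card Λ then (1 : ℂ) else 0) *
          (creation (orb x σ) * annihilation (orb y τ))) = 0 := by
  rw [hubbard_gibbsState_numberProj_mul_creation_mul_annihilation G ε hε t U μ β hxy, if_neg hne,
    zero_mul]

/-- **Eq. (5), canonical (uniform density)**: `Tr[Π n_{xσ} e^{-β(H-μN)}] = ½ Tr[Π e^{-β(H-μN)}]`, i.e.
the canonical half-filled Gibbs state has `⟨n_{xσ}⟩ = ½` at every site, spin, temperature and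
coupling. [cite: LiebLossMccann1993, Theorem eq. (5)] -/
theorem hubbard_gibbsState_numberProj_mul_numberOp (ε : Λ → ℤˣ)
    (hε : ∀ x y, G.Adj x y → ε x = -ε y) (t U μ β : ℝ) (x : Λ) (σ : Fin 2) :
    gibbsState β (hamiltonianWith G t U μ)
        (diagonal (fun s : Finset (Orb Λ) => if s.card = Fintype.card Λ then (1 : ℂ) else 0) *
          numberOp x σ) =
      (1 / 2 : ℂ) * gibbsState β (hamiltonianWith G t U μ)
        (diagonal (fun s : Finset (Orb Λ) => if s.card = Fintype.card Λ then (1 : ℂ) else 0)) := by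
  rw [numberOp, hubbard_gibbsState_numberProj_mul_creation_mul_annihilation G ε hε t U μ β rfl,
    if_pos rfl]

end Hubbard

/-! ### §6 Zero-temperature limits: the tracial ground states (LLM Remark III)

"If we define the ground state `ρ_σ` as the limit `β → ∞` of the canonical `ρ̃_{βσ}`, then (5) and (6)
apply there, too. … Of course, the ground state is not generally unique, and there are other
possibilities for `ρ_σ`, in which case (5) and (6) apply to states that are invariant under `Y = WJ`."
(LLM p. 895, Remark III.) The `β → ∞` limits exist and are the TRACIAL ground states (uniform mixtures
over the ground eigenspace): `Matrix.tendsto_gibbsState_atTop_holds` (whole Fock space) and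
`tendsto_sectorGibbsAverage_atTop` (a particle-number sector). No uniqueness, connectedness, `|A| = |B|`
or sign of `U` is needed — compare `HubbardOneBodyDensityMatrix.lean` (THE unique ground state under
Lieb's hypotheses). -/

section GroundStates

variable {ι : Type*} [LinearOrder ι] [Fintype ι]

/-- **The orthogonal projection onto the `N`-particle sector is the occupation-basis indicator**
`diag(1_{|s| = N})` (`projMatrix` of `nParticleSubmodule N`, transported to `EuclideanSpace`): the
indicator fixes the sector and its complement `ψ - Π ψ` is orthogonal to the sector. [folklore]
[cite: LiebLossMccann1993, p. 893 ("the trace is only over the `N`-particle sector")] -/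
theorem projMatrix_map_nParticleSubmodule_eq_diagonal (N : ℕ) :
    projMatrix ((nParticleSubmodule (ι := ι) N).map
        ((WithLp.linearEquiv 2 ℂ (Fock ι)).symm : Fock ι →ₗ[ℂ] EuclideanSpace ℂ (Finset ι))) =
      diagonal (fun s : Finset ι => if s.card = N then (1 : ℂ) else 0) := by
  apply matrix_eq_of_mulVec_eq
  intro ψ
  set Q : Matrix (Finset ι) (Finset ι) ℂ := diagonal (fun s : Finset ι => if s.card = N then (1 : ℂ) else 0)
    with hQ
  have hmem : Q *ᵥ ψ ∈ nParticleSubmodule (ι := ι) N := by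
    rw [mem_nParticleSubmodule_iff]
    intro s hs
    rw [hQ, mulVec_diagonal, if_neg hs, zero_mul]
  have horth : ∀ w ∈ nParticleSubmodule (ι := ι) N, star w ⬝ᵥ (ψ - Q *ᵥ ψ) = 0 := by
    intro w hw
    rw [mem_nParticleSubmodule_iff] at hw
    simp only [dotProduct, Pi.sub_apply, hQ, mulVec_diagonal, Pi.star_apply]
    refine Finset.sum_eq_zero fun s _ => ?_
    by_cases hs : s.card = N
    · rw [if_pos hs, one_mul, sub_self, mul_zero]
    · rw [hw s hs, star_zero, zero_mul]
  calc projMatrix ((nParticleSubmodule (ι := ι) N).map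
          ((WithLp.linearEquiv 2 ℂ (Fock ι)).symm : Fock ι →ₗ[ℂ] EuclideanSpace ℂ (Finset ι))) *ᵥ ψ
      = projMatrix ((nParticleSubmodule (ι := ι) N).map
          ((WithLp.linearEquiv 2 ℂ (Fock ι)).symm : Fock ι →ₗ[ℂ] EuclideanSpace ℂ (Finset ι))) *ᵥ
            (Q *ᵥ ψ + (ψ - Q *ᵥ ψ)) := by rw [add_sub_cancel]
    _ = Q *ᵥ ψ + 0 := by
        rw [mulVec_add, projMatrix_map_mulVec_of_mem _ hmem,
          projMatrix_map_mulVec_eq_zero_of_orthogonal _ horth]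
    _ = Q *ᵥ ψ := add_zero _

variable {Λ : Type*} [LinearOrder Λ] [Fintype Λ] (G : SimpleGraph Λ) [DecidableRel G.Adj]

open _root_.Filter _root_.Topology

/-- **LLM Remark III, grand-canonical form: the tracial ground state of `H(t,U) - (U/2)N`** (the
`β → ∞` limit of the grand-canonical Gibbs state, i.e. the uniform mixture of ALL its ground states,
`Matrix.groundStateFunctional`) satisfies eqs. (5)–(6): `ω₀(c†_{xσ} c_{yτ}) = ½ δ_{(x,σ),(y,τ)}` whenever
`ε x = ε y` — on every finite graph with a bipartite sign, for every real `t`, `U`.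
[cite: LiebLossMccann1993, Remark III (p. 895) with Theorem eqs. (5)-(6)] -/
theorem hubbard_groundStateFunctional_creation_mul_annihilation_halfFilling (ε : Λ → ℤˣ)
    (hε : ∀ x y, G.Adj x y → ε x = -ε y) (t U : ℝ) {x y : Λ} (hxy : ε x = ε y) (σ τ : Fin 2) :
    (hamiltonianWith G t U (U / 2)).groundStateFunctional (creation (orb x σ) * annihilation (orb y τ)) =
      if orb x σ = orb y τ then (1 / 2 : ℂ) else 0 := by
  have hlim := Matrix.tendsto_gibbsState_atTop_holds (isHermitian_hamiltonianWith G t U (U / 2))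
    (creation (orb x σ) * annihilation (orb y τ))
  have hconst : Tendsto (fun β : ℝ => gibbsState β (hamiltonianWith G t U (U / 2))
      (creation (orb x σ) * annihilation (orb y τ))) atTop
      (𝓝 (if orb x σ = orb y τ then (1 / 2 : ℂ) else 0)) := by
    have hfun : (fun β : ℝ => gibbsState β (hamiltonianWith G t U (U / 2))
        (creation (orb x σ) * annihilation (orb y τ))) =
        fun _ => if orb x σ = orb y τ then (1 / 2 : ℂ) else 0 :=
      funext fun β => hubbard_gibbsState_creation_mul_annihilation_halfFilling G ε hε t U β hxy σ τ
    rw [hfun]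
    exact tendsto_const_nhds
  exact tendsto_nhds_unique hlim hconst

/-- The half-filled sector `N = |Λ|` of the Fock space is non-trivial. [folklore] -/
private theorem nParticleSubmodule_card_ne_bot :
    nParticleSubmodule (ι := Orb Λ) (Fintype.card Λ) ≠ ⊥ := by
  obtain ⟨s, -, hs⟩ := Finset.exists_subset_card_eq
    (show Fintype.card Λ ≤ (Finset.univ : Finset (Orb Λ)).card by
      rw [Finset.card_univ, card_orb]; omega)
  rw [Submodule.ne_bot_iff]
  refine ⟨fun u => if u = s then 1 else 0, ?_, ?_⟩
  · rw [mem_nParticleSubmodule_iff]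
    intro u hu
    show (if u = s then (1 : ℂ) else 0) = 0
    rw [if_neg]
    rintro rfl
    exact hu hs
  · intro h
    have := congrFun h s
    simp at this

/-- **LLM Remark III, canonical form: the tracial ground state of the half-filled sector** — the
`β → ∞` limit of the canonical Gibbs state of the `|Λ|`-electron sector, i.e. the uniform mixture of
ALL half-filled ground states of `H(t,U)` (`sectorGroundProj … |>.projState`, e.g. Lieb's `(2S+1)`-fold
multiplet when `|A| ≠ |B|`) — satisfies eqs. (5)–(6): `ω(c†_{xσ} c_{yτ}) = ½ δ_{(x,σ),(y,τ)}` whenever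
`ε x = ε y`, on every finite graph with a bipartite sign and for every real `t`, `U` (no uniqueness
needed). [cite: LiebLossMccann1993, Remark III (p. 895) with Theorem eqs. (5)-(6)] -/
theorem hubbard_sectorGroundState_creation_mul_annihilation_halfFilling (ε : Λ → ℤˣ)
    (hε : ∀ x y, G.Adj x y → ε x = -ε y) (t U : ℝ) {x y : Λ} (hxy : ε x = ε y) (σ τ : Fin 2) :
    ((hamiltonian G t U).sectorGroundProj (nParticleSubmodule (Fintype.card Λ))).projState
        (creation (orb x σ) * annihilation (orb y τ)) =
      if orb x σ = orb y τ then (1 / 2 : ℂ) else 0 := by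
  set H := hamiltonian G t U with hHdef
  set K : Submodule ℂ (Fock (Orb Λ)) := nParticleSubmodule (ι := Orb Λ) (Fintype.card Λ) with hKdef
  set A : Matrix (Finset (Orb Λ)) (Finset (Orb Λ)) ℂ := creation (orb x σ) * annihilation (orb y τ)
    with hAdef
  set Q : Matrix (Finset (Orb Λ)) (Finset (Orb Λ)) ℂ :=
    diagonal (fun s : Finset (Orb Λ) => if s.card = Fintype.card Λ then (1 : ℂ) else 0) with hQdef
  set c : ℂ := if orb x σ = orb y τ then (1 / 2 : ℂ) else 0 with hcdef
  have hH : H.IsHermitian := (hamiltonian_isHermitian_and_commute_holds G t U).1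
  have hHN : Commute H totalNumber := (hamiltonian_isHermitian_and_commute_holds G t U).2.1
  have hinv : ∀ v ∈ K, H *ᵥ v ∈ K := fun v hv => by
    rw [hKdef, mem_nParticleSubmodule_iff] at hv ⊢
    exact LiebTwo.isNParticle_mulVec_of_commute hv hHN.symm
  have hlim := tendsto_sectorGibbsAverage_atTop hH K hinv
    (inf_eigenspace_minEnergyOn_ne_bot hH K hinv nParticleSubmodule_card_ne_bot) A
  rw [hKdef, projMatrix_map_nParticleSubmodule_eq_diagonal, ← hKdef, ← hQdef] at hlim
  -- the canonical Gibbs average is constant in `β`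
  have hQH : Q * H = H * Q :=
    numberProj_comm_of_card_eq H (fun s s' h => card_eq_of_hamiltonianWith_apply_ne_zero G t U 0 s s'
      (by rwa [hamiltonianWith_zero])) _
  have hconstβ : ∀ β : ℝ, (Q * gibbsWeight β H * A).trace / (Q * gibbsWeight β H).trace = c := by
    intro β
    have hcW : Commute (gibbsWeight β H) Q := by
      have h1 : Commute (-(β : ℂ) • H) Q := (Commute.smul_left (show Commute H Q from hQH.symm) _)
      exact h1.exp_left
    have hZ : partitionFn β H ≠ 0 := (partitionFn_pos β hH).ne'
    -- the canonical theorem at `μ = 0`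
    have hcan := hubbard_gibbsState_numberProj_mul_creation_mul_annihilation G ε hε t U 0 β hxy σ τ
    rw [hamiltonianWith_zero, ← hHdef, ← hQdef, ← hAdef, ← hcdef, gibbsState_apply, gibbsState_apply]
      at hcan
    have htr : (gibbsWeight β H * (Q * A)).trace = c * (gibbsWeight β H * Q).trace := by
      have h2 : (partitionFn β H)⁻¹ * (gibbsWeight β H * (Q * A)).trace =
          (partitionFn β H)⁻¹ * (c * (gibbsWeight β H * Q).trace) := by
        rw [hcan]; ring
      exact mul_left_cancel₀ (inv_ne_zero hZ) h2
    -- `tr (Q W) ≠ 0`: the diagonal entries of the positive definite `W` are positive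
    have hpos : 0 < (Q * gibbsWeight β H).trace := by
      obtain ⟨s, -, hs⟩ := Finset.exists_subset_card_eq
        (show Fintype.card Λ ≤ (Finset.univ : Finset (Orb Λ)).card by
          rw [Finset.card_univ, card_orb]; omega)
      have hW := posDef_gibbsWeight β hH
      rw [Matrix.trace]
      simp only [Matrix.diag_apply, hQdef, diagonal_mul, ite_mul, one_mul, zero_mul]
      refine Finset.sum_pos' (fun u _ => ?_) ⟨s, Finset.mem_univ _, ?_⟩
      · split_ifs
        · exact (hW.diag_pos).le
        · exact le_rfl
      · rw [if_pos hs]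
        exact hW.diag_pos
    rw [← hcW.eq, Matrix.mul_assoc, htr, Matrix.trace_mul_comm (gibbsWeight β H) Q,
      mul_div_assoc, div_self hpos.ne', mul_one]
  have hconst : Tendsto (fun β : ℝ => (Q * gibbsWeight β H * A).trace / (Q * gibbsWeight β H).trace)
      atTop (𝓝 c) := by
    rw [show (fun β : ℝ => (Q * gibbsWeight β H * A).trace / (Q * gibbsWeight β H).trace) = fun _ => c
      from funext hconstβ]
    exact tendsto_const_nhds
  have heq := tendsto_nhds_unique hlim hconst
  rw [Matrix.projState_apply, Matrix.sectorGroundProj, Matrix.sectorGroundSpace, ← div_eq_inv_mul]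
  exact heq

/-- **Eq. (5) for the tracial half-filled ground state**: `⟨n_{xσ}⟩ = ½` at every site and spin — the
uniform density of the (mixture of all) half-filled ground states, every bipartite-signed graph, every
`t`, `U`. [cite: LiebLossMccann1993, Remark III with Theorem eq. (5)] -/
theorem hubbard_sectorGroundState_numberOp_halfFilling (ε : Λ → ℤˣ)
    (hε : ∀ x y, G.Adj x y → ε x = -ε y) (t U : ℝ) (x : Λ) (σ : Fin 2) :
    ((hamiltonian G t U).sectorGroundProj (nParticleSubmodule (Fintype.card Λ))).projState
        (numberOp x σ) = 1 / 2 := by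
  rw [numberOp, hubbard_sectorGroundState_creation_mul_annihilation_halfFilling G ε hε t U rfl, if_pos rfl]

/-- **Eq. (6) for the tracial half-filled ground state**: `⟨c†_{xσ} c_{yτ}⟩ = 0` for distinct orbitals
on the same sublattice. [cite: LiebLossMccann1993, Remark III with Theorem eq. (6)] -/
theorem hubbard_sectorGroundState_creation_mul_annihilation_eq_zero (ε : Λ → ℤˣ)
    (hε : ∀ x y, G.Adj x y → ε x = -ε y) (t U : ℝ) {x y : Λ} (hxy : ε x = ε y) {σ τ : Fin 2}
    (hne : orb x σ ≠ orb y τ) :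
    ((hamiltonian G t U).sectorGroundProj (nParticleSubmodule (Fintype.card Λ))).projState
        (creation (orb x σ) * annihilation (orb y τ)) = 0 := by
  rw [hubbard_sectorGroundState_creation_mul_annihilation_halfFilling G ε hε t U hxy, if_neg hne]

end GroundStates

/-! ### §7 Complex hopping: invariance under the antiunitary `Y = JW` (LLM, "the complex case")

"The complex case is a bit subtle. The Hamiltonian `H` is no longer invariant under the hole–particle
transformation `W`, but it is invariant under the antiunitary transformation `Y = JW`, in which `J` is
complex conjugation. … `Tr L = (Tr K)^*`. … `Z ρ_{βσ}(x,y)^* = Tr[c_{xσ} c†_{yσ} e^{-βH}] =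
Z (δ_{xy} − ρ_{βσ}(y,x))`. The hermiticity of `ρ_{βσ}` now implies the theorem." (LLM p. 893.)
In matrix language complex conjugation is `M ↦ Mᵀᴴ` (entrywise `conj`), `conj ⟨A⟩_{β,K} = ⟨Aᵀᴴ⟩_{β,Kᵀᴴ}`,
and `Y`-invariance of a Hermitian `K` reads `P Kᵀ Pᴴ = K`; the real case `Kᴴ = Kᵀ` of §2–§3 is the
special case `Kᵀ = K̄ = K`-up-to-`P`. -/

section ComplexHopping

variable {m : Type*} [Fintype m] [DecidableEq m]

omit [DecidableEq m] in
/-- Entrywise complex conjugation `M ↦ Mᵀᴴ` is multiplicative. [folklore] -/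
private theorem transpose_conjTranspose_mul (A B : Matrix m m ℂ) : (A * B)ᵀᴴ = Aᵀᴴ * Bᵀᴴ := by
  rw [transpose_mul, conjTranspose_mul]

omit [Fintype m] [DecidableEq m] in
/-- `Mᵀᴴ = Mᴴᵀ` (both are the entrywise conjugate). [folklore] -/
private theorem transpose_conjTranspose_eq_conjTranspose_transpose (M : Matrix m m ℂ) : Mᵀᴴ = Mᴴᵀ := by
  ext i j
  rfl

omit [Fintype m] [DecidableEq m] in
/-- A real matrix (`Mᴴ = Mᵀ`) is fixed by entrywise conjugation: `Mᵀᴴ = M`. [folklore] -/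
private theorem transpose_conjTranspose_of_real {M : Matrix m m ℂ} (hM : Mᴴ = Mᵀ) : Mᵀᴴ = M := by
  rw [← hM, conjTranspose_conjTranspose]

omit [DecidableEq m] in
/-- `conj (tr M) = tr (Mᵀᴴ)` ("`Tr L = (Tr K)^*`"). [cite: LiebLossMccann1993, proof of Theorem (complex case)] -/
theorem star_trace_eq_trace_transpose_conjTranspose (M : Matrix m m ℂ) : star M.trace = (Mᵀᴴ).trace := by
  rw [trace_conjTranspose, trace_transpose]

/-- **Complex conjugation of the Gibbs weight**: `(e^{-βK})ᵀᴴ = e^{-β Kᵀᴴ}` (real `β`).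
[cite: LiebLossMccann1993, proof of Theorem (complex case, `Y e^{-βH} Y`)] -/
theorem gibbsWeight_transpose_conjTranspose (β : ℝ) (K : Matrix m m ℂ) :
    (gibbsWeight β K)ᵀᴴ = gibbsWeight β Kᵀᴴ := by
  unfold gibbsWeight
  rw [← Matrix.exp_transpose, ← Matrix.exp_conjTranspose, transpose_smul, conjTranspose_smul, star_neg,
    Complex.star_def, Complex.conj_ofReal]

/-- **Complex conjugation of a Gibbs expectation**: `conj ⟨A⟩_{β,K} = ⟨Aᵀᴴ⟩_{β,Kᵀᴴ}` — LLM's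
`Tr[J X J] = (Tr X)^*` applied to `Z` and to `Tr[A e^{-βK}]`.
[cite: LiebLossMccann1993, proof of Theorem (complex case)] -/
theorem star_gibbsState_eq_gibbsState_transpose_conjTranspose (β : ℝ) (K A : Matrix m m ℂ) :
    star (gibbsState β K A) = gibbsState β Kᵀᴴ Aᵀᴴ := by
  rw [gibbsState_apply, gibbsState_apply, star_mul', star_inv₀, partitionFn, partitionFn,
    star_trace_eq_trace_transpose_conjTranspose, star_trace_eq_trace_transpose_conjTranspose,
    transpose_conjTranspose_mul, gibbsWeight_transpose_conjTranspose]

/-- **Unitary covariance of Gibbs states**: `⟨Wᴴ B W⟩_{β, Wᴴ X W} = ⟨B⟩_{β,X}` for unitary `W`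
(`e^{Wᴴ X W} = Wᴴ e^X W`, cyclicity of the trace). [cite: BratteliRobinsonII1997, §5.3.1] -/
theorem gibbsState_unitary_conj (β : ℝ) {W : Matrix m m ℂ} (hWW : Wᴴ * W = 1) (hWW' : W * Wᴴ = 1)
    (X B : Matrix m m ℂ) : gibbsState β (Wᴴ * X * W) (Wᴴ * B * W) = gibbsState β X B := by
  have hU : IsUnit Wᴴ := ⟨⟨Wᴴ, W, hWW, hWW'⟩, rfl⟩
  have hinv : Wᴴ⁻¹ = W := Matrix.inv_eq_right_inv hWW
  have hexp : gibbsWeight β (Wᴴ * X * W) = Wᴴ * gibbsWeight β X * W := by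
    unfold gibbsWeight
    rw [show -(β : ℂ) • (Wᴴ * X * W) = Wᴴ * (-(β : ℂ) • X) * Wᴴ⁻¹ by
      rw [hinv, Matrix.mul_smul, Matrix.smul_mul], Matrix.exp_conj _ _ hU, hinv]
  have h1 : (Wᴴ * gibbsWeight β X * W).trace = (gibbsWeight β X).trace := by
    rw [Matrix.trace_mul_cycle, hWW', Matrix.one_mul]
  have h2 : (Wᴴ * gibbsWeight β X * W * (Wᴴ * B * W)).trace = (gibbsWeight β X * B).trace := by
    have e : Wᴴ * gibbsWeight β X * W * (Wᴴ * B * W) = Wᴴ * (gibbsWeight β X * B) * W := by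
      calc Wᴴ * gibbsWeight β X * W * (Wᴴ * B * W)
          = Wᴴ * gibbsWeight β X * (W * Wᴴ) * B * W := by simp only [Matrix.mul_assoc]
        _ = Wᴴ * (gibbsWeight β X * B) * W := by rw [hWW', Matrix.mul_one, Matrix.mul_assoc Wᴴ]
    rw [e, Matrix.trace_mul_cycle, hWW', Matrix.one_mul]
  rw [gibbsState_apply, gibbsState_apply, partitionFn, partitionFn, hexp, h1, h2]

variable {ι : Type*} [LinearOrder ι] [Fintype ι]

/-- The particle–hole conjugate of a one-body operator: `P c†_a c_b Pᴴ = ε_a ε_b (δ_{ab} − c†_b c_a)`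
(`P c Pᴴ = ε c†`, `P c† Pᴴ = conj(ε) c`, CAR). [cite: LiebLossMccann1993, proof of Theorem (eq. (7) and "the fermion commutation rule")] -/
theorem particleHole_mul_creation_mul_annihilation_mul_conjTranspose (ε : ι → ℤˣ) (a b : ι) :
    particleHole (fun i => ((ε i : ℤ) : ℂ)) * (creation a * annihilation b) *
        (particleHole (fun i => ((ε i : ℤ) : ℂ)))ᴴ =
      (((ε a : ℤ) : ℂ) * ((ε b : ℤ) : ℂ)) •
        ((if a = b then (1 : Matrix (Finset ι) (Finset ι) ℂ) else 0) - creation b * annihilation a) := by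
  set ε' : ι → ℂ := fun i => ((ε i : ℤ) : ℂ) with hε'
  have hn : ∀ i, ‖ε' i‖ = 1 := fun i => norm_intCast_units _
  set P := particleHole ε' with hPdef
  have hPP : Pᴴ * P = 1 := particleHole_conjTranspose_mul ε' hn
  have hsplit : P * (creation a * annihilation b) * Pᴴ =
      (P * creation a * Pᴴ) * (P * annihilation b * Pᴴ) := by
    simp only [Matrix.mul_assoc]
    rw [← Matrix.mul_assoc Pᴴ P, hPP, Matrix.one_mul]
  have hcar : annihilation a * creation b = (if a = b then 1 else 0) - creation b * annihilation a :=
    eq_sub_of_add_eq (annihilation_mul_creation_add_creation_mul_annihilation_holds a b)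
  have hstar : star (ε' a) = ε' a := by
    simp only [hε']
    exact star_intCast_units _
  rw [hsplit, particleHole_mul_creation_mul_conjTranspose ε' hn a,
    particleHole_mul_annihilation_mul_conjTranspose_holds ε' hn b, Matrix.smul_mul, Matrix.mul_smul,
    smul_smul, hcar, hstar]

/-- **Lieb–Loss–McCann's theorem in the complex case (`Y = JW`-invariant Hamiltonians), grand
canonical**: if `K` is Hermitian and `P Kᵀ Pᴴ = K` for the particle–hole unitary `P` of a sign
`ε : ι → ℤˣ` (equivalently `Y K Y = K` with `Y = J P`; for real `K` this is `P K Pᴴ = K`), then at every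
`β`, `⟨c†_a c_b⟩_{β,K} = ½ δ_{ab}` for orbitals of the same sign. Covers COMPLEX bipartite hopping
(magnetic fields): `P (t_{xy} c†_x c_y)ᵀ Pᴴ = -ε_x ε_y t_{xy} c†_x c_y = t_{xy} c†_x c_y` on an edge.
[cite: LiebLossMccann1993, Theorem eqs. (5)-(6), proof (complex case, p. 893)] -/
theorem gibbsState_creation_mul_annihilation_eq_half_ite_of_transpose (β : ℝ)
    {K : Matrix (Finset ι) (Finset ι) ℂ} (hK : K.IsHermitian) (ε : ι → ℤˣ)
    (hPK : particleHole (fun i => ((ε i : ℤ) : ℂ)) * Kᵀ * (particleHole (fun i => ((ε i : ℤ) : ℂ)))ᴴ = K)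
    {a b : ι} (hab : ε a = ε b) :
    gibbsState β K (creation a * annihilation b) = if a = b then (1 / 2 : ℂ) else 0 := by
  set ε' : ι → ℂ := fun i => ((ε i : ℤ) : ℂ) with hε'
  have hn : ∀ i, ‖ε' i‖ = 1 := fun i => norm_intCast_units _
  set P := particleHole ε' with hPdef
  have hPP : Pᴴ * P = 1 := particleHole_conjTranspose_mul ε' hn
  have hPP' : P * Pᴴ = 1 := particleHole_mul_conjTranspose ε' hn
  have hZ : partitionFn β K ≠ 0 := (partitionFn_pos β hK).ne'
  -- `Kᵀᴴ = Kᵀ = Pᴴ K P`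
  have hKbar : Kᵀᴴ = Pᴴ * K * P := by
    rw [transpose_conjTranspose_eq_conjTranspose_transpose, hK.eq]
    calc Kᵀ = (Pᴴ * P) * Kᵀ * (Pᴴ * P) := by rw [hPP, Matrix.one_mul, Matrix.mul_one]
      _ = Pᴴ * (P * Kᵀ * Pᴴ) * P := by simp only [Matrix.mul_assoc]
      _ = Pᴴ * K * P := by rw [hPK]
  -- the real observable `B = c†_b c_a`
  have hBreal : (creation b * annihilation a)ᴴ = (creation b * annihilation a)ᵀ :=
    conjTranspose_eq_transpose_mul (conjTranspose_creation_eq_transpose b)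
      (conjTranspose_annihilation_eq_transpose a)
  -- `conj ρ(b,a) = ⟨P c†_b c_a Pᴴ⟩ = ε_b ε_a (δ_{ba} − ρ(a,b))`
  have h1 : star (gibbsState β K (creation b * annihilation a)) =
      ((ε b : ℤ) : ℂ) * ((ε a : ℤ) : ℂ) *
        ((if b = a then 1 else 0) - gibbsState β K (creation a * annihilation b)) := by
    have hite : gibbsState β K (if b = a then (1 : Matrix (Finset ι) (Finset ι) ℂ) else 0) =
        if b = a then 1 else 0 := by
      split_ifs
      · exact gibbsState_one β K hZ
      · exact map_zero _
    rw [star_gibbsState_eq_gibbsState_transpose_conjTranspose, hKbar, transpose_conjTranspose_of_real hBreal,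
      show creation b * annihilation a = Pᴴ * (P * (creation b * annihilation a) * Pᴴ) * P by
        simp only [Matrix.mul_assoc]
        rw [hPP, Matrix.mul_one, ← Matrix.mul_assoc, hPP, Matrix.one_mul],
      gibbsState_unitary_conj β hPP hPP', hPdef, hε',
      particleHole_mul_creation_mul_annihilation_mul_conjTranspose ε b a, map_smul, map_sub, hite,
      smul_eq_mul]
  -- hermiticity: `conj ρ(b,a) = ρ(a,b)`
  have h2 : star (gibbsState β K (creation b * annihilation a)) =
      gibbsState β K (creation a * annihilation b) := by
    rw [← gibbsState_conjTranspose β hK, conjTranspose_mul, annihilation_conjTranspose,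
      creation_conjTranspose]
  rw [h2, hab, intCast_units_mul_self, one_mul] at h1
  by_cases h : a = b
  · subst h
    rw [if_pos rfl] at h1 ⊢
    linear_combination h1 / 2
  · rw [if_neg (Ne.symm h)] at h1
    rw [if_neg h]
    linear_combination h1 / 2

/-- **The complex case, canonical ensemble**: under the same `Y`-invariance `P Kᵀ Pᴴ = K`, if `K`
conserves the particle number entrywise and `2N = |ι|`, then with `Π = diag(1_{|s| = N})`,
`⟨Π c†_a c_b⟩_{β,K} = ½ δ_{ab} ⟨Π⟩_{β,K}` for orbitals of the same sign ("The proof for `ρ̃_{βσ}` will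
be the same"). [cite: LiebLossMccann1993, Theorem eqs. (5)-(6), proof (complex case)] -/
theorem gibbsState_numberProj_mul_creation_mul_annihilation_eq_of_transpose (β : ℝ)
    {K : Matrix (Finset ι) (Finset ι) ℂ} (hK : K.IsHermitian)
    (hKN : ∀ s s' : Finset ι, K s s' ≠ 0 → s.card = s'.card) (ε : ι → ℤˣ)
    (hPK : particleHole (fun i => ((ε i : ℤ) : ℂ)) * Kᵀ * (particleHole (fun i => ((ε i : ℤ) : ℂ)))ᴴ = K)
    {N : ℕ} (hN : 2 * N = Fintype.card ι) {a b : ι} (hab : ε a = ε b) :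
    gibbsState β K (diagonal (fun s : Finset ι => if s.card = N then (1 : ℂ) else 0) *
        (creation a * annihilation b)) =
      (if a = b then (1 / 2 : ℂ) else 0) *
        gibbsState β K (diagonal (fun s : Finset ι => if s.card = N then (1 : ℂ) else 0)) := by
  set Q : Matrix (Finset ι) (Finset ι) ℂ :=
    diagonal (fun s : Finset ι => if s.card = N then (1 : ℂ) else 0) with hQdef
  set ε' : ι → ℂ := fun i => ((ε i : ℤ) : ℂ) with hε'
  have hn : ∀ i, ‖ε' i‖ = 1 := fun i => norm_intCast_units _
  set P := particleHole ε' with hPdef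
  have hPP : Pᴴ * P = 1 := particleHole_conjTranspose_mul ε' hn
  have hPP' : P * Pᴴ = 1 := particleHole_mul_conjTranspose ε' hn
  have hQK : Q * K = K * Q := numberProj_comm_of_card_eq K hKN N
  have hQherm : Qᴴ = Q := numberProj_conjTranspose N
  have hQreal : Qᴴ = Qᵀ := by rw [hQherm, hQdef, diagonal_transpose]
  have hPQ : P * Q * Pᴴ = Q := by
    rw [hQdef, hPdef, particleHole_mul_numberProj_mul_conjTranspose ε' hn (by omega)]
    congr 1
    funext s
    rw [show Fintype.card ι - N = N by omega]
  have hKbar : Kᵀᴴ = Pᴴ * K * P := by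
    rw [transpose_conjTranspose_eq_conjTranspose_transpose, hK.eq]
    calc Kᵀ = (Pᴴ * P) * Kᵀ * (Pᴴ * P) := by rw [hPP, Matrix.one_mul, Matrix.mul_one]
      _ = Pᴴ * (P * Kᵀ * Pᴴ) * P := by simp only [Matrix.mul_assoc]
      _ = Pᴴ * K * P := by rw [hPK]
  -- `φ(A) = ⟨Q A⟩` is Hermitian (needs `[Q, K] = 0`)
  have hH : ∀ A, gibbsState β K (Q * Aᴴ) = star (gibbsState β K (Q * A)) := by
    intro A
    rw [← gibbsState_conjTranspose β hK, conjTranspose_mul, hQherm, gibbsState_mul_comm_of_commute β hQK]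
  -- `conj φ(c†_b c_a) = ε_b ε_a (δ_{ba} φ(1) − φ(c†_a c_b))`
  set B : Matrix (Finset ι) (Finset ι) ℂ := creation b * annihilation a with hBdef
  have hBreal : Bᴴ = Bᵀ :=
    conjTranspose_eq_transpose_mul (conjTranspose_creation_eq_transpose b)
      (conjTranspose_annihilation_eq_transpose a)
  have hQBreal : (Q * B)ᴴ = (Q * B)ᵀ := conjTranspose_eq_transpose_mul hQreal hBreal
  have h1 : star (gibbsState β K (Q * B)) =
      ((ε b : ℤ) : ℂ) * ((ε a : ℤ) : ℂ) *
        ((if b = a then gibbsState β K Q else 0) - gibbsState β K (Q * (creation a * annihilation b))) := by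
    have hite : gibbsState β K (Q * (if b = a then (1 : Matrix (Finset ι) (Finset ι) ℂ) else 0)) =
        if b = a then gibbsState β K Q else 0 := by
      split_ifs
      · rw [Matrix.mul_one]
      · rw [Matrix.mul_zero, map_zero]
    have e : Q * B = Pᴴ * (Q * (P * B * Pᴴ)) * P := by
      calc Q * B = (Pᴴ * P) * Q * (Pᴴ * P) * B * (Pᴴ * P) := by rw [hPP]; simp only [Matrix.one_mul, Matrix.mul_one]
        _ = Pᴴ * ((P * Q * Pᴴ) * (P * B * Pᴴ)) * P := by simp only [Matrix.mul_assoc]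
        _ = Pᴴ * (Q * (P * B * Pᴴ)) * P := by rw [hPQ]
    rw [star_gibbsState_eq_gibbsState_transpose_conjTranspose, hKbar, transpose_conjTranspose_of_real hQBreal,
      e, gibbsState_unitary_conj β hPP hPP', hBdef, hPdef, hε',
      particleHole_mul_creation_mul_annihilation_mul_conjTranspose ε b a, Matrix.mul_smul, map_smul,
      Matrix.mul_sub, map_sub, hite, smul_eq_mul]
  have h2 : star (gibbsState β K (Q * B)) = gibbsState β K (Q * (creation a * annihilation b)) := by
    rw [← hH, hBdef, conjTranspose_mul, annihilation_conjTranspose, creation_conjTranspose]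
  rw [h2, hab, intCast_units_mul_self, one_mul] at h1
  by_cases h : a = b
  · subst h
    rw [if_pos rfl] at h1 ⊢
    linear_combination h1 / 2
  · rw [if_neg (Ne.symm h)] at h1
    rw [if_neg h]
    linear_combination h1 / 2

end ComplexHopping

/-! ### §5 The even torus `(ℤ/Lℤ)^d`

(The general statements are instantiated at `G = fermionTorusGraph d L`, `ε = torusStagger`; `convert`
closes the propositional mismatch between the two `DecidableEq (FermionTorus d L)` instance paths.) -/

section Torus

variable {d L : ℕ}

/-- **LLM eqs. (5)–(6) on the even torus, grand canonical**: for `L` even, every `d`, `t`, `U`, `β`,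
the Gibbs state of `hubbardTorusWith d L t U (U/2)` has `⟨c†_{xσ} c_{yτ}⟩_β = ½ δ_{(x,σ),(y,τ)}`
whenever `x, y` have the same parity (`ε_x = ε_y`, `ε = (-1)^{Σ xᵢ}` = `torusStagger`).
[cite: LiebLossMccann1993, Theorem eqs. (5)-(6)] -/
theorem hubbardTorus_gibbsState_creation_mul_annihilation_halfFilling (hL : Even L) (t U β : ℝ)
    {x y : FermionTorus d L} (hxy : torusStagger x = torusStagger y) (σ τ : Fin 2) :
    gibbsState β (hubbardTorusWith d L t U (U / 2)) (creation (orb x σ) * annihilation (orb y τ)) =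
      if orb x σ = orb y τ then (1 / 2 : ℂ) else 0 := by
  have h := hubbard_gibbsState_creation_mul_annihilation_halfFilling (fermionTorusGraph d L)
    torusStagger (fun _ _ h => torusStagger_eq_neg_of_adj_holds hL h) t U β hxy σ τ
  unfold hubbardTorusWith
  convert h

/-- **Uniform density on the even torus, grand canonical**: `⟨n_{xσ}⟩_β = ½` and `⟨N⟩_β = |Λ| = L^d`
for `hubbardTorusWith d L t U (U/2)`, every `β`. [cite: LiebLossMccann1993, Theorem eq. (5)] -/
theorem hubbardTorus_gibbsState_numberOp_halfFilling (hL : Even L) (t U β : ℝ) (x : FermionTorus d L)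
    (σ : Fin 2) :
    gibbsState β (hubbardTorusWith d L t U (U / 2)) (numberOp x σ) = 1 / 2 ∧
      gibbsState β (hubbardTorusWith d L t U (U / 2)) totalNumber = Fintype.card (FermionTorus d L) := by
  have h1 := hubbard_gibbsState_numberOp_halfFilling (fermionTorusGraph d L) torusStagger
      (fun _ _ h => torusStagger_eq_neg_of_adj_holds hL h) t U β x σ
  have h2 := hubbard_gibbsState_totalNumber_halfFilling (fermionTorusGraph d L) torusStagger
      (fun _ _ h => torusStagger_eq_neg_of_adj_holds hL h) t U β
  unfold hubbardTorusWith
  constructor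
  · convert h1
  · convert h2

/-- **LLM eqs. (5)–(6) on the even torus, canonical ensemble at half filling** (`N = L^d`
electrons, any `μ`): `⟨Π c†_{xσ} c_{yτ}⟩_{β, H-μN} = ½ δ ⟨Π⟩_{β, H-μN}` for `x, y` of the same parity.
[cite: LiebLossMccann1993, Theorem eqs. (5)-(6)] -/
theorem hubbardTorus_gibbsState_numberProj_mul_creation_mul_annihilation (hL : Even L)
    (t U μ β : ℝ) {x y : FermionTorus d L} (hxy : torusStagger x = torusStagger y) (σ τ : Fin 2) :
    gibbsState β (hubbardTorusWith d L t U μ)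
        (diagonal (fun s : Finset (Orb (FermionTorus d L)) =>
            if s.card = Fintype.card (FermionTorus d L) then (1 : ℂ) else 0) *
          (creation (orb x σ) * annihilation (orb y τ))) =
      (if orb x σ = orb y τ then (1 / 2 : ℂ) else 0) *
        gibbsState β (hubbardTorusWith d L t U μ)
          (diagonal (fun s : Finset (Orb (FermionTorus d L)) =>
            if s.card = Fintype.card (FermionTorus d L) then (1 : ℂ) else 0)) := by
  have h := hubbard_gibbsState_numberProj_mul_creation_mul_annihilation (fermionTorusGraph d L)
    torusStagger (fun _ _ h => torusStagger_eq_neg_of_adj_holds hL h) t U μ β hxy σ τ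
  unfold hubbardTorusWith
  convert h

end Torus

end Literature.MathematicalPhysics.QuantumLattice
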